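import Mathlib
import Summits.NavierStokesRegularity.NavierStokesRegularity.Theorems.FilamentSkeletonRssClause13RHomogeneity
import Summits.NavierStokesRegularity.NavierStokesRegularity.Theorems.FilamentSkeletonRssClause13RTransversality

/-!
# Clause 13-R: STUB R is NECESSARY — the crux `Clause13RNearStraightL` BY NAME implies the registered rate row `RateRow13RFlat`,
# its homogeneous form `R♭` and the transversality form `R♯` (line `rate_bordered_split` of crux stmt-NavierStokesRegularity-23612)

Route `FilamentSkeletonRss`, Variant A1R.  The registered line `Cruxes/Clause13RNearStraightL/Lines/rate_bordered_split.lean` (sha 098fbcf79f64745c)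
composes the crux 13-R from STUB R (`RateRow13RFlat`: a FLAT bordered in-ball defect `‖DT·Y − dα·R_j‖ ≤ L` forces `|dα|√Γ ≤ cnd·L`, prefix
`∀ b, ∃ (cnd Γ₀)`) and STUB J (`Clamped13JBordered`).  The landed bookkeeping records `R ⟹ R″` (leaky row, `…Clause13RLeakySplit`),
`R ⟺ R♭ ⟺ R♯` (`…Clause13RHomogeneity`, `…Clause13RTransversality`) and `crux ⟺ crux-without-envelope`
(`…Clause13RHomogeneity.clause13RNearStraightL_iff_noEnvelope`), but not the CONVERSE direction of the split on the R-side.  THIS FILE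
(structural, kernel-checked, def-free, texts verbatim):

* `rateRow13RFlat_of_clause13RNearStraightL` — **the crux BY NAME implies STUB R's registered text**: given the crux's own exponents
  `(a, b₀)` with `a ≥ 0`, a flat in-ball defect bound `≤ L` at an in-ball station forces `0 ≤ L`, hence `L ≤ L(1+|τ−c_j|)^a`, so the crux's
  hypothesis holds and its second conclusion is the rate bound; the `∀ b` prefix and the envelope of STUB R are served through the
  envelope-free form of the crux (`noEnvelope_of_clause13RNearStraightL`), so NO rescaling is needed here;
* `homogeneous_of_clause13RNearStraightL`, `transversality_of_clause13RNearStraightL` — hence the crux implies `R♭` and the exact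
  transversality statement `R♯` («for all large `Γ`, every skeleton of the class, every admissible `Y`: `‖DT·Y_j − R_j‖ ≤ L` on the balls
  ⟹ `√Γ ≤ cnd·L`»), by composition with p823524 / p823674.

READING (planner-facing).  The R-half of the registered split is LOSS-FREE: STUB R is not merely sufficient (with J) but NECESSARY for the crux.
Consequently (i) a `stub-false` on `stub_rateRow13RFlat` — equivalently any admissible `Y` bringing the rate column within `o(√Γ)` of the image of
`DT` on the balls for a sequence `Γ → ∞` at fixed box constants — refutes the Summit.NavierStokesRegularity.NavierStokesRegularity.Theses.FilamentSkeletonRss.Clause13RNearStraightL `Clause13RNearStraightL` itself (item 23612), hence every line of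
23612 and the stub `stub_clause13R` of the line of record v7 of `SkeletonJ1R` (stmt-23610), not just this line; (ii) the leaky re-split `R″ ∧ J`
(`…Clause13RLeakySplit`) reorganises the PROOF (it moves `Y`-control to J) but cannot weaken the TARGET: `R″ ∧ J ⟹ crux ⟹ R`; (iii) the parallel
disprover's attacks on R are attacks on 23612 by name.  No statement about STUB J's necessity is made (J's bordered forcing envelope
`L(1+|τ−c_j|/√Γ)` exceeds what the crux returns at `dα = 0` unless the crux's exponent `a` is positive, which the crux does not disclose).

Hand `leafhand-ns-filamentskeletonrs-27-g0` (LAND-ONLY); `--supports stmt-NavierStokesRegularity-23612` helper.  HONEST FRAMING: soft bookkeeping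
about the registered statements of a clause on a HYPOTHETICAL near-straight filament skeleton on the NEGATIVE side of a MODEL blow-up route; STUB R,
STUB J and the crux are NOT proved here, and nothing in this file bears on Navier–Stokes regularity or blow-up. [folklore]
-/

noncomputable section

open Real Filter MeasureTheory Literature.Analysis.FluidPDE
open scoped RealInnerProductSpace InnerProductSpace Topology BigOperators

namespace Summit.NavierStokesRegularity.NavierStokesRegularity.Theorems.Clause13RRateRowNecessity
set_option linter.dupNamespace false

/-- **STUB R is necessary.**  The crux `Clause13RNearStraightL` BY NAME implies the registered text of STUB R (`RateRow13RFlat` of the line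
`rate_bordered_split`, verbatim): with the crux's own `(a, b₀, cnd, Γ₀)` (`a ≥ 0`), a flat in-ball defect `≤ L` gives `0 ≤ L ≤ L(1+|τ−c_j|)^a`,
and the crux's rate conclusion is the claim; the arbitrary envelope exponent `b` of STUB R is absorbed by the envelope-free form of the crux
(`Clause13RHomogeneity.noEnvelope_of_clause13RNearStraightL`). [folklore] -/
theorem rateRow13RFlat_of_clause13RNearStraightL :
    Summit.NavierStokesRegularity.NavierStokesRegularity.Theses.FilamentSkeletonRss.Clause13RNearStraightL →
    (open Literature.Analysis.FluidPDE in ∀ (N : ℕ) (δ ρ K Λ Rw cg θ₀ KA : ℝ), 0 < N → 0 < δ → 0 < ρ → 0 < Rw → 0 < cg → 0 < θ₀ → ∃ Rb₀ : ℝ, 0 < Rb₀ ∧ ∀ Rb : ℝ, 0 < Rb → Rb ≤ Rb₀ → ∀ b : ℝ, ∃ (cnd Γ₀ : ℝ), 0 < cnd ∧ ∀ Γ : ℝ, Γ₀ ≤ Γ → ∀ (γ : Fin N → ℝ) (α : ℝ) (X : Fin N → ℝ → EuclideanSpace ℝ (Fin 3)) (w : Fin N → ℝ → ℝ) (c : Fin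 N → ℝ) (Aa : Fin N → ℝ → ℝ), (∀ (u:(Fin N → ℝ → EuclideanSpace ℝ (Fin 3)) → EuclideanSpace ℝ (Fin 3) → EuclideanSpace ℝ (Fin 3)) (v:EuclideanSpace ℝ (Fin 3) → EuclideanSpace ℝ (Fin 3)) (A:Fin N → (EuclideanSpace ℝ (Fin 3) →L[ℝ] EuclideanSpace ℝ (Fin 3))) (T:(Fin N → ℝ → EuclideanSpace ℝ (Fin 3)) → Fin N → ℝ → EuclideanSpace ℝ (Fin 3)), (∀ Z y, u Z y = ∑ k, (Γ*γ k/(4*Real.pi))•∫ σ:ℝ, ((‖y-Z k σ‖^2+Real.exp (-(1+Real.eulerMascheroniConstant-Real.log 2))*Aa k σ)^(3/2:ℝ))⁻¹•cross (deriv (Z k) σ) (y-Z k σ))→(∀ y, v y = u X y+(1/2:ℝ)•y-α•cross (EuclideanSpace.single 2 1) y)→(∀ j, A j = fderiv ℝ v (X j (c j)))→(∀ Z j τ, T Z j τ = (u Z (Z j τ)+(1/2:ℝ)•Z j τ-α•cross (EuclideanSpace.single 2 1) (Z j τ))-(⟪u Z (Z j τ)+(1/2:ℝ)•Z j τ-α•cross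 (EuclideanSpace.single 2 1) (Z j τ), deriv (Z j) τ⟫_ℝ/‖deriv (Z j) τ‖^2)•deriv (Z j) τ)→(α ≠ 0 ∧ (∀ j, γ j ≠ 0) ∧ (∀ j, ContDiff ℝ 2 (X j) ∧ Differentiable ℝ (w j)∧(∀ τ, ‖deriv (X j) τ‖ = 1)∧(∀ τ, ‖iteratedDeriv 2 (X j) τ‖*√Γ≤K) ∧ Tendsto (fun τ => ‖X j τ‖) (cocompact ℝ) atTop) ∧ (∀ j k, j ≠ k → ∀ τ σ, ρ*√Γ≤‖X j τ-X k σ‖) ∧ (∀ j τ σ, ρ*√Γ≤|τ-σ| → cg*ρ*√Γ≤‖X j τ-X j σ‖) ∧ (∀ j τ, cg*|τ-c j|≤Rw*√Γ+‖X j τ‖) ∧ (∀ j τ, w j τ = ⟪v (X j τ), deriv (X j) τ⟫_ℝ) ∧ (∀ j τ, ‖X j τ‖≤Rb*√(Γ*Real.log Γ) → v (X j τ) = w j τ•deriv (X j) τ) ∧ (∀ j, ‖X j (c j)‖≤Rw*√Γ) ∧ (∀ j, |⟪deriv (X j) (c j), EuclideanSpace.single 2 1⟫_ℝ|≤1-θ₀)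 ∧ (θ₀≤|α| ∧ |α|≤θ₀⁻¹ ∧ ∀ j, θ₀≤|γ j| ∧ |γ j|≤θ₀⁻¹) ∧ (∀ j, w j (c j) = 0 ∧ (∀ τ, w j τ = 0 → τ = c j) ∧ 3/2+δ≤deriv (w j) (c j) ∧ deriv (w j) (c j)≤Λ) ∧ (∀ j, Differentiable ℝ (Aa j) ∧ (∀ τ, 0 < Aa j τ) ∧ 1≤KA*Aa j (c j) ∧ ∀ τ, ‖X j τ‖≤2*Rb*√(Γ*Real.log Γ) → Aa j τ = Aa j (c j)) ∧ (∀ j τ, Rw^2*Γ*Aa j τ≤KA*(Rw^2*Γ+‖X j τ‖^2)))) → ((∀ j τ σ, ‖deriv (X j) τ - deriv (X j) σ‖ ≤ Rb) ∧ (∀ j τ, |deriv (w j) τ| ≤ Λ) ∧ (∀ j τ, Λ⁻¹ ≤ Aa j τ)) → (∀ (u:(Fin N → ℝ → EuclideanSpace ℝ (Fin 3)) → EuclideanSpace ℝ (Fin 3) → EuclideanSpace ℝ (Fin 3)) (v:EuclideanSpace ℝ (Fin 3) → EuclideanSpace ℝ (Fin 3)) (A:Fin N → (EuclideanSpace ℝ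 (Fin 3) →L[ℝ] EuclideanSpace ℝ (Fin 3))) (T:(Fin N → ℝ → EuclideanSpace ℝ (Fin 3)) → Fin N → ℝ → EuclideanSpace ℝ (Fin 3)), (∀ Z y, u Z y = ∑ k, (Γ*γ k/(4*Real.pi))•∫ σ:ℝ, ((‖y-Z k σ‖^2+Real.exp (-(1+Real.eulerMascheroniConstant-Real.log 2))*Aa k σ)^(3/2:ℝ))⁻¹•cross (deriv (Z k) σ) (y-Z k σ))→(∀ y, v y = u X y+(1/2:ℝ)•y-α•cross (EuclideanSpace.single 2 1) y)→(∀ j, A j = fderiv ℝ v (X j (c j)))→(∀ Z j τ, T Z j τ = (u Z (Z j τ)+(1/2:ℝ)•Z j τ-α•cross (EuclideanSpace.single 2 1) (Z j τ))-(⟪u Z (Z j τ)+(1/2:ℝ)•Z j τ-α•cross (EuclideanSpace.single 2 1) (Z j τ), deriv (Z j) τ⟫_ℝ/‖deriv (Z j) τ‖^2)•deriv (Z j) τ)→(∀ Y:Fin N → ℝ → EuclideanSpace ℝ (Fin 3), (∀ j, ContDiff ℝ 2 (Y j))→(∀ j τ, ⟪Y j τ, deriv (X j) τ⟫_ℝ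 = 0) → (∀ j τ, Rb*√(Γ*Real.log Γ) < ‖X j τ‖ → Y j τ = 0) → ∑ j, ⟪Y j (c j), cross (EuclideanSpace.single 2 1) (X j (c j))⟫_ℝ = 0 → (∀ j τ, ‖Y j τ‖+‖deriv (Y j) τ‖+‖iteratedDeriv 2 (Y j) τ‖≤(1+|τ-c j|)^b) → ∀ dα L:ℝ, (∀ j τ, ‖X j τ‖≤Rb*√(Γ*Real.log Γ) → ‖deriv (fun s:ℝ => T (fun k σ => X k σ+s•Y k σ) j τ) 0-dα•(cross (EuclideanSpace.single 2 1) (X j τ)-⟪cross (EuclideanSpace.single 2 1) (X j τ), deriv (X j) τ⟫_ℝ•deriv (X j) τ)‖≤L) → |dα| * √Γ≤cnd*L))) := by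
  intro hC N δ ρ K Λ Rw cg θ₀ KA hN hδ hρ hRw hcg hθ₀
  obtain ⟨Rb₀, hRb₀, hfam⟩ :=
    Clause13RHomogeneity.noEnvelope_of_clause13RNearStraightL hC N δ ρ K Λ Rw cg θ₀ KA hN hδ hρ hRw hcg hθ₀
  refine ⟨Rb₀, hRb₀, fun Rb hRb hRble _b => ?_⟩
  obtain ⟨a, b₀, cnd, Γ₀, ha, hcnd, hΓ⟩ := hfam Rb hRb hRble
  refine ⟨cnd, Γ₀, hcnd, fun Γ hΓle => ?_⟩
  intro γ α X w c Aa hH hNS u v A T hu hv hA hT Y hY2 hYn hYoff hYph _hYenv dα L hdef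
  refine (hΓ Γ hΓle γ α X w c Aa hH hNS u v A T hu hv hA hT Y hY2 hYn hYoff hYph dα L fun j τ hin => ?_).2
  have h := hdef j τ hin
  have hL : 0 ≤ L := (norm_nonneg _).trans h
  have hone : (1 : ℝ) ≤ (1 + |τ - c j|) ^ a :=
    Real.one_le_rpow (by linarith [abs_nonneg (τ - c j)]) ha
  exact h.trans (le_mul_of_one_le_right hL hone)

/-- Hence the crux implies the HOMOGENEOUS rate row `R♭` (composition with `Clause13RHomogeneity.homogeneous_of_rateRow13RFlat`, p823524). [folklore] -/
theorem homogeneous_of_clause13RNearStraightL :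
    Summit.NavierStokesRegularity.NavierStokesRegularity.Theses.FilamentSkeletonRss.Clause13RNearStraightL →
    (open Literature.Analysis.FluidPDE in ∀ (N : ℕ) (δ ρ K Λ Rw cg θ₀ KA : ℝ), 0 < N → 0 < δ → 0 < ρ → 0 < Rw → 0 < cg → 0 < θ₀ → ∃ Rb₀ : ℝ, 0 < Rb₀ ∧ ∀ Rb : ℝ, 0 < Rb → Rb ≤ Rb₀ → ∃ (cnd Γ₀ : ℝ), 0 < cnd ∧ ∀ Γ : ℝ, Γ₀ ≤ Γ → ∀ (γ : Fin N → ℝ) (α : ℝ) (X : Fin N → ℝ → EuclideanSpace ℝ (Fin 3)) (w : Fin N → ℝ → ℝ) (c : Fin N → ℝ) (Aa : Fin N → ℝ → ℝ), (∀ (u:(Fin N → ℝ → EuclideanSpace ℝ (Fin 3)) → EuclideanSpace ℝ (Fin 3) → EuclideanSpace ℝ (Fin 3)) (v:EuclideanSpace ℝ (Fin 3) → EuclideanSpace ℝ (Fin 3)) (A:Fin N → (EuclideanSpace ℝ (Fin 3) →L[ℝ] EuclideanSpace ℝ (Fin 3))) (T:(Fin N → ℝ → EuclideanSpace ℝ (Fin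 3)) → Fin N → ℝ → EuclideanSpace ℝ (Fin 3)), (∀ Z y, u Z y = ∑ k, (Γ*γ k/(4*Real.pi))•∫ σ:ℝ, ((‖y-Z k σ‖^2+Real.exp (-(1+Real.eulerMascheroniConstant-Real.log 2))*Aa k σ)^(3/2:ℝ))⁻¹•cross (deriv (Z k) σ) (y-Z k σ))→(∀ y, v y = u X y+(1/2:ℝ)•y-α•cross (EuclideanSpace.single 2 1) y)→(∀ j, A j = fderiv ℝ v (X j (c j)))→(∀ Z j τ, T Z j τ = (u Z (Z j τ)+(1/2:ℝ)•Z j τ-α•cross (EuclideanSpace.single 2 1) (Z j τ))-(⟪u Z (Z j τ)+(1/2:ℝ)•Z j τ-α•cross (EuclideanSpace.single 2 1) (Z j τ), deriv (Z j) τ⟫_ℝ/‖deriv (Z j) τ‖^2)•deriv (Z j) τ)→(α ≠ 0 ∧ (∀ j, γ j ≠ 0) ∧ (∀ j, ContDiff ℝ 2 (X j) ∧ Differentiable ℝ (w j)∧(∀ τ, ‖deriv (X j) τ‖ = 1)∧(∀ τ, ‖iteratedDeriv 2 (X j) τ‖*√Γ≤K) ∧ Tendsto (fun τ => ‖X j τ‖)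 (cocompact ℝ) atTop) ∧ (∀ j k, j ≠ k → ∀ τ σ, ρ*√Γ≤‖X j τ-X k σ‖) ∧ (∀ j τ σ, ρ*√Γ≤|τ-σ| → cg*ρ*√Γ≤‖X j τ-X j σ‖) ∧ (∀ j τ, cg*|τ-c j|≤Rw*√Γ+‖X j τ‖) ∧ (∀ j τ, w j τ = ⟪v (X j τ), deriv (X j) τ⟫_ℝ) ∧ (∀ j τ, ‖X j τ‖≤Rb*√(Γ*Real.log Γ) → v (X j τ) = w j τ•deriv (X j) τ) ∧ (∀ j, ‖X j (c j)‖≤Rw*√Γ) ∧ (∀ j, |⟪deriv (X j) (c j), EuclideanSpace.single 2 1⟫_ℝ|≤1-θ₀) ∧ (θ₀≤|α| ∧ |α|≤θ₀⁻¹ ∧ ∀ j, θ₀≤|γ j| ∧ |γ j|≤θ₀⁻¹) ∧ (∀ j, w j (c j) = 0 ∧ (∀ τ, w j τ = 0 → τ = c j) ∧ 3/2+δ≤deriv (w j) (c j) ∧ deriv (w j) (c j)≤Λ) ∧ (∀ j, Differentiable ℝ (Aa j) ∧ (∀ τ, 0 < Aa j τ) ∧ 1≤KA*Aa j (c j) ∧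 ∀ τ, ‖X j τ‖≤2*Rb*√(Γ*Real.log Γ) → Aa j τ = Aa j (c j)) ∧ (∀ j τ, Rw^2*Γ*Aa j τ≤KA*(Rw^2*Γ+‖X j τ‖^2)))) → ((∀ j τ σ, ‖deriv (X j) τ - deriv (X j) σ‖ ≤ Rb) ∧ (∀ j τ, |deriv (w j) τ| ≤ Λ) ∧ (∀ j τ, Λ⁻¹ ≤ Aa j τ)) → (∀ (u:(Fin N → ℝ → EuclideanSpace ℝ (Fin 3)) → EuclideanSpace ℝ (Fin 3) → EuclideanSpace ℝ (Fin 3)) (v:EuclideanSpace ℝ (Fin 3) → EuclideanSpace ℝ (Fin 3)) (A:Fin N → (EuclideanSpace ℝ (Fin 3) →L[ℝ] EuclideanSpace ℝ (Fin 3))) (T:(Fin N → ℝ → EuclideanSpace ℝ (Fin 3)) → Fin N → ℝ → EuclideanSpace ℝ (Fin 3)), (∀ Z y, u Z y = ∑ k, (Γ*γ k/(4*Real.pi))•∫ σ:ℝ, ((‖y-Z k σ‖^2+Real.exp (-(1+Real.eulerMascheroniConstant-Real.log 2))*Aa k σ)^(3/2:ℝ))⁻¹•cross (deriv (Z k) σ)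 (y-Z k σ))→(∀ y, v y = u X y+(1/2:ℝ)•y-α•cross (EuclideanSpace.single 2 1) y)→(∀ j, A j = fderiv ℝ v (X j (c j)))→(∀ Z j τ, T Z j τ = (u Z (Z j τ)+(1/2:ℝ)•Z j τ-α•cross (EuclideanSpace.single 2 1) (Z j τ))-(⟪u Z (Z j τ)+(1/2:ℝ)•Z j τ-α•cross (EuclideanSpace.single 2 1) (Z j τ), deriv (Z j) τ⟫_ℝ/‖deriv (Z j) τ‖^2)•deriv (Z j) τ)→(∀ Y:Fin N → ℝ → EuclideanSpace ℝ (Fin 3), (∀ j, ContDiff ℝ 2 (Y j))→(∀ j τ, ⟪Y j τ, deriv (X j) τ⟫_ℝ = 0) → (∀ j τ, Rb*√(Γ*Real.log Γ) < ‖X j τ‖ → Y j τ = 0) → ∑ j, ⟪Y j (c j), cross (EuclideanSpace.single 2 1) (X j (c j))⟫_ℝ = 0 → ∀ dα L:ℝ, (∀ j τ, ‖X j τ‖≤Rb*√(Γ*Real.log Γ) → ‖deriv (fun s:ℝ => T (fun k σ => X k σ+s•Y k σ) j τ) 0-dα•(cross (EuclideanSpace.single 2 1) (X j τ)-⟪cross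 (EuclideanSpace.single 2 1) (X j τ), deriv (X j) τ⟫_ℝ•deriv (X j) τ)‖≤L) → |dα| * √Γ≤cnd*L))) :=
  fun hC => Clause13RHomogeneity.homogeneous_of_rateRow13RFlat (rateRow13RFlat_of_clause13RNearStraightL hC)

/-- … and the TRANSVERSALITY form `R♯` (no `dα`: `‖DT·Y_j − R_j‖ ≤ L` on the balls forces `√Γ ≤ cnd·L`), by composition with
`Clause13RTransversality.transversality_of_homogeneous` (p823674): exact transversality of the rate column to the image of the admissible cone
under `DT` is a CONSEQUENCE of the crux, not only an ingredient of one line. [folklore] -/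
theorem transversality_of_clause13RNearStraightL :
    Summit.NavierStokesRegularity.NavierStokesRegularity.Theses.FilamentSkeletonRss.Clause13RNearStraightL →
    (open Literature.Analysis.FluidPDE in ∀ (N : ℕ) (δ ρ K Λ Rw cg θ₀ KA : ℝ), 0 < N → 0 < δ → 0 < ρ → 0 < Rw → 0 < cg → 0 < θ₀ → ∃ Rb₀ : ℝ, 0 < Rb₀ ∧ ∀ Rb : ℝ, 0 < Rb → Rb ≤ Rb₀ → ∃ (cnd Γ₀ : ℝ), 0 < cnd ∧ ∀ Γ : ℝ, Γ₀ ≤ Γ → ∀ (γ : Fin N → ℝ) (α : ℝ) (X : Fin N → ℝ → EuclideanSpace ℝ (Fin 3)) (w : Fin N → ℝ → ℝ) (c : Fin N → ℝ) (Aa : Fin N → ℝ → ℝ), (∀ (u:(Fin N → ℝ → EuclideanSpace ℝ (Fin 3)) → EuclideanSpace ℝ (Fin 3) → EuclideanSpace ℝ (Fin 3)) (v:EuclideanSpace ℝ (Fin 3) → EuclideanSpace ℝ (Fin 3)) (A:Fin N → (EuclideanSpace ℝ (Fin 3) →L[ℝ] EuclideanSpace ℝ (Fin 3))) (T:(Fin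 N → ℝ → EuclideanSpace ℝ (Fin 3)) → Fin N → ℝ → EuclideanSpace ℝ (Fin 3)), (∀ Z y, u Z y = ∑ k, (Γ*γ k/(4*Real.pi))•∫ σ:ℝ, ((‖y-Z k σ‖^2+Real.exp (-(1+Real.eulerMascheroniConstant-Real.log 2))*Aa k σ)^(3/2:ℝ))⁻¹•cross (deriv (Z k) σ) (y-Z k σ))→(∀ y, v y = u X y+(1/2:ℝ)•y-α•cross (EuclideanSpace.single 2 1) y)→(∀ j, A j = fderiv ℝ v (X j (c j)))→(∀ Z j τ, T Z j τ = (u Z (Z j τ)+(1/2:ℝ)•Z j τ-α•cross (EuclideanSpace.single 2 1) (Z j τ))-(⟪u Z (Z j τ)+(1/2:ℝ)•Z j τ-α•cross (EuclideanSpace.single 2 1) (Z j τ), deriv (Z j) τ⟫_ℝ/‖deriv (Z j) τ‖^2)•deriv (Z j) τ)→(α ≠ 0 ∧ (∀ j, γ j ≠ 0) ∧ (∀ j, ContDiff ℝ 2 (X j) ∧ Differentiable ℝ (w j)∧(∀ τ, ‖deriv (X j) τ‖ = 1)∧(∀ τ, ‖iteratedDeriv 2 (X j) τ‖*√Γ≤K)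 ∧ Tendsto (fun τ => ‖X j τ‖) (cocompact ℝ) atTop) ∧ (∀ j k, j ≠ k → ∀ τ σ, ρ*√Γ≤‖X j τ-X k σ‖) ∧ (∀ j τ σ, ρ*√Γ≤|τ-σ| → cg*ρ*√Γ≤‖X j τ-X j σ‖) ∧ (∀ j τ, cg*|τ-c j|≤Rw*√Γ+‖X j τ‖) ∧ (∀ j τ, w j τ = ⟪v (X j τ), deriv (X j) τ⟫_ℝ) ∧ (∀ j τ, ‖X j τ‖≤Rb*√(Γ*Real.log Γ) → v (X j τ) = w j τ•deriv (X j) τ) ∧ (∀ j, ‖X j (c j)‖≤Rw*√Γ) ∧ (∀ j, |⟪deriv (X j) (c j), EuclideanSpace.single 2 1⟫_ℝ|≤1-θ₀) ∧ (θ₀≤|α| ∧ |α|≤θ₀⁻¹ ∧ ∀ j, θ₀≤|γ j| ∧ |γ j|≤θ₀⁻¹) ∧ (∀ j, w j (c j) = 0 ∧ (∀ τ, w j τ = 0 → τ = c j) ∧ 3/2+δ≤deriv (w j) (c j) ∧ deriv (w j) (c j)≤Λ) ∧ (∀ j, Differentiable ℝ (Aa j) ∧ (∀ τ, 0 < Aa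 j τ) ∧ 1≤KA*Aa j (c j) ∧ ∀ τ, ‖X j τ‖≤2*Rb*√(Γ*Real.log Γ) → Aa j τ = Aa j (c j)) ∧ (∀ j τ, Rw^2*Γ*Aa j τ≤KA*(Rw^2*Γ+‖X j τ‖^2)))) → ((∀ j τ σ, ‖deriv (X j) τ - deriv (X j) σ‖ ≤ Rb) ∧ (∀ j τ, |deriv (w j) τ| ≤ Λ) ∧ (∀ j τ, Λ⁻¹ ≤ Aa j τ)) → (∀ (u:(Fin N → ℝ → EuclideanSpace ℝ (Fin 3)) → EuclideanSpace ℝ (Fin 3) → EuclideanSpace ℝ (Fin 3)) (v:EuclideanSpace ℝ (Fin 3) → EuclideanSpace ℝ (Fin 3)) (A:Fin N → (EuclideanSpace ℝ (Fin 3) →L[ℝ] EuclideanSpace ℝ (Fin 3))) (T:(Fin N → ℝ → EuclideanSpace ℝ (Fin 3)) → Fin N → ℝ → EuclideanSpace ℝ (Fin 3)), (∀ Z y, u Z y = ∑ k, (Γ*γ k/(4*Real.pi))•∫ σ:ℝ, ((‖y-Z k σ‖^2+Real.exp (-(1+Real.eulerMascheroniConstant-Real.log 2))*Aa k σ)^(3/2:ℝ))⁻¹•cross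 (deriv (Z k) σ) (y-Z k σ))→(∀ y, v y = u X y+(1/2:ℝ)•y-α•cross (EuclideanSpace.single 2 1) y)→(∀ j, A j = fderiv ℝ v (X j (c j)))→(∀ Z j τ, T Z j τ = (u Z (Z j τ)+(1/2:ℝ)•Z j τ-α•cross (EuclideanSpace.single 2 1) (Z j τ))-(⟪u Z (Z j τ)+(1/2:ℝ)•Z j τ-α•cross (EuclideanSpace.single 2 1) (Z j τ), deriv (Z j) τ⟫_ℝ/‖deriv (Z j) τ‖^2)•deriv (Z j) τ)→(∀ Y:Fin N → ℝ → EuclideanSpace ℝ (Fin 3), (∀ j, ContDiff ℝ 2 (Y j))→(∀ j τ, ⟪Y j τ, deriv (X j) τ⟫_ℝ = 0) → (∀ j τ, Rb*√(Γ*Real.log Γ) < ‖X j τ‖ → Y j τ = 0) → ∑ j, ⟪Y j (c j), cross (EuclideanSpace.single 2 1) (X j (c j))⟫_ℝ = 0 → ∀ L:ℝ, (∀ j τ, ‖X j τ‖≤Rb*√(Γ*Real.log Γ) → ‖deriv (fun s:ℝ => T (fun k σ => X k σ+s•Y k σ) j τ) 0-(cross (EuclideanSpace.single 2 1) (X j τ)-⟪cross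 (EuclideanSpace.single 2 1) (X j τ), deriv (X j) τ⟫_ℝ•deriv (X j) τ)‖≤L) → √Γ≤cnd*L))) :=
  fun hC => Clause13RTransversality.transversality_of_homogeneous (homogeneous_of_clause13RNearStraightL hC)

end Summit.NavierStokesRegularity.NavierStokesRegularity.Theorems.Clause13RRateRowNecessity

end
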